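import Mathlib
import HarnessLib
import Summits.AtomisticToContinuum.HydrodynamicLimit.Theses.RelayRaceLocality

/-!
# RelayRaceLocality · ConeLocalisation — the cone-transfer lemma (abstract probability)

Support file for item `stmt-AtomisticToContinuum-12504` (`ConeLocalisation`, route
RelayRaceLocality of `AtomisticToContinuum/HydrodynamicLimit`).

The light cone in law (`LightConeInLaw`) compares two gases only through
`E₁ F(X₁) - E₂ F(X₂) → 0` for every `1`-Lipschitz `F` bounded by `1`, where `Xᵢ` are the
reduced empirical fields tested against a bump `χ`. The glue `ConeLocalisation` needs to turn
this, together with convergence IN PROBABILITY of the comparison gas (`X₂ → v`), into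
convergence in probability of the conjunct's gas (`X₁ → v`). This file proves exactly that
transfer, in the abstract: for probability measures `P₁ N`, `P₂ N`, measurable `X₁ N`, `X₂ N`
with values in a pseudo-metric space and a point `v`,
`(∀ F 1-Lip, |F| ≤ 1, E₁F(X₁) - E₂F(X₂) → 0) ∧ (∀ δ>0, P₂(δ < dist(X₂,v)) → 0)
  ⇒ ∀ δ>0, P₁(δ < dist(X₁,v)) → 0`,
via the test function `F = min(δ'/2, (dist(·,v) - δ'/2)₊)`, `δ' = min δ 1`.
-/

namespace Summit.AtomisticToContinuum.HydrodynamicLimit.Theorems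

open scoped Topology ENNReal
open Filter Set MeasureTheory

/-- **Cone transfer.** If the laws of `X₁ N` under `P₁ N` and of `X₂ N` under `P₂ N` merge in the
bounded-Lipschitz sense (`∫ F(X₁) dP₁ - ∫ F(X₂) dP₂ → 0` for all `1`-Lipschitz `F` with
`|F| ≤ 1`) and `X₂ N → v` in `P₂`-probability, then `X₁ N → v` in `P₁`-probability. [folklore] -/
theorem relayRaceLocality_coneTransfer
    {Ω₁ Ω₂ : ℕ → Type*} [∀ N, MeasurableSpace (Ω₁ N)] [∀ N, MeasurableSpace (Ω₂ N)]
    {E : Type*} [PseudoMetricSpace E] [MeasurableSpace E] [OpensMeasurableSpace E]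
    (P₁ : ∀ N, Measure (Ω₁ N)) (P₂ : ∀ N, Measure (Ω₂ N))
    [∀ N, IsProbabilityMeasure (P₁ N)] [∀ N, IsProbabilityMeasure (P₂ N)]
    {X₁ : ∀ N, Ω₁ N → E} {X₂ : ∀ N, Ω₂ N → E}
    (hX₁ : ∀ N, Measurable (X₁ N)) (hX₂ : ∀ N, Measurable (X₂ N)) (v : E)
    (hF : ∀ F : E → ℝ, LipschitzWith 1 F → (∀ p, |F p| ≤ 1) →
      Tendsto (fun N => (∫ ω, F (X₁ N ω) ∂P₁ N) - ∫ ω, F (X₂ N ω) ∂P₂ N) atTop (𝓝 0))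
    (h₂ : ∀ δ : ℝ, 0 < δ → Tendsto (fun N => P₂ N {ω | δ < dist (X₂ N ω) v}) atTop (𝓝 0)) :
    ∀ δ : ℝ, 0 < δ → Tendsto (fun N => P₁ N {ω | δ < dist (X₁ N ω) v}) atTop (𝓝 0) := by
  intro δ hδ
  -- the truncated test function
  set δ' : ℝ := min δ 1 with hδ'
  have hδ'pos : 0 < δ' := lt_min hδ one_pos
  have hδ'le : δ' ≤ δ := min_le_left _ _
  have hδ'le1 : δ' ≤ 1 := min_le_right _ _
  set F : E → ℝ := fun p => min (δ' / 2) (max 0 (dist p v - δ' / 2)) with hFdef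
  have hL0 : LipschitzWith 1 (fun p : E => dist p v - δ' / 2) :=
    LipschitzWith.of_le_add fun x y => by linarith [dist_triangle x y v]
  have hFlip : LipschitzWith 1 F := (hL0.const_max 0).const_min (δ' / 2)
  have hFcont : Continuous F := hFlip.continuous
  have hF0 : ∀ p, 0 ≤ F p := fun p => le_min (by linarith) (le_max_left _ _)
  have hFle : ∀ p, F p ≤ δ' / 2 := fun p => min_le_left _ _
  have hFbd : ∀ p, |F p| ≤ 1 := fun p => by
    rw [abs_of_nonneg (hF0 p)]; linarith [hFle p]
  -- value δ'/2 far from v, value 0 near v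
  have hFfar : ∀ p, δ < dist p v → F p = δ' / 2 := fun p hp => by
    refine min_eq_left ?_
    refine le_trans ?_ (le_max_right _ _)
    linarith
  have hFnear : ∀ p, ¬ δ' / 2 < dist p v → F p = 0 := fun p hp => by
    have : max 0 (dist p v - δ' / 2) = 0 := max_eq_left (by linarith [not_lt.1 hp])
    simp only [hFdef, this]
    exact min_eq_right (by linarith)
  -- measurability / integrability
  have hmeasd₁ : ∀ N, Measurable fun ω => dist (X₁ N ω) v := fun N =>
    (continuous_id.dist continuous_const).measurable.comp (hX₁ N)
  have hmeasd₂ : ∀ N, Measurable fun ω => dist (X₂ N ω) v := fun N =>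
    (continuous_id.dist continuous_const).measurable.comp (hX₂ N)
  have hA₁ : ∀ N, MeasurableSet {ω | δ < dist (X₁ N ω) v} := fun N =>
    measurableSet_lt measurable_const (hmeasd₁ N)
  have hA₂ : ∀ N, MeasurableSet {ω | δ' / 2 < dist (X₂ N ω) v} := fun N =>
    measurableSet_lt measurable_const (hmeasd₂ N)
  have hint₁ : ∀ N, Integrable (fun ω => F (X₁ N ω)) (P₁ N) := fun N =>
    Integrable.of_bound (hFcont.measurable.comp (hX₁ N)).aestronglyMeasurable 1
      (ae_of_all _ fun ω => by simpa [Real.norm_eq_abs] using hFbd (X₁ N ω))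
  have hint₂ : ∀ N, Integrable (fun ω => F (X₂ N ω)) (P₂ N) := fun N =>
    Integrable.of_bound (hFcont.measurable.comp (hX₂ N)).aestronglyMeasurable 1
      (ae_of_all _ fun ω => by simpa [Real.norm_eq_abs] using hFbd (X₂ N ω))
  -- lower bound for gas 1: (δ'/2) P₁(A₁) ≤ ∫ F(X₁)
  have hlow : ∀ N, δ' / 2 * (P₁ N {ω | δ < dist (X₁ N ω) v}).toReal ≤ ∫ ω, F (X₁ N ω) ∂P₁ N := by
    intro N
    have h1 : ∫ ω in {ω | δ < dist (X₁ N ω) v}, F (X₁ N ω) ∂P₁ N =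
        ∫ ω in {ω | δ < dist (X₁ N ω) v}, (δ' / 2 : ℝ) ∂P₁ N :=
      setIntegral_congr_fun (hA₁ N) fun ω hω => hFfar _ hω
    have h2 : ∫ ω in {ω | δ < dist (X₁ N ω) v}, (δ' / 2 : ℝ) ∂P₁ N =
        δ' / 2 * (P₁ N {ω | δ < dist (X₁ N ω) v}).toReal := by
      rw [setIntegral_const, smul_eq_mul, mul_comm]; rfl
    rw [← h2, ← h1]
    exact setIntegral_le_integral (hint₁ N) (ae_of_all _ fun ω => hF0 _)
  -- upper bound for gas 2: ∫ F(X₂) ≤ (δ'/2) P₂(A₂')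
  have hup : ∀ N, ∫ ω, F (X₂ N ω) ∂P₂ N ≤ δ' / 2 * (P₂ N {ω | δ' / 2 < dist (X₂ N ω) v}).toReal := by
    intro N
    have h1 : ∫ ω, F (X₂ N ω) ∂P₂ N ≤
        ∫ ω, {ω | δ' / 2 < dist (X₂ N ω) v}.indicator (fun _ => (δ' / 2 : ℝ)) ω ∂P₂ N := by
      refine integral_mono (hint₂ N) ((integrable_const _).indicator (hA₂ N)) fun ω => ?_
      by_cases hω : δ' / 2 < dist (X₂ N ω) v
      · simp only [Set.indicator_of_mem (show ω ∈ {ω | δ' / 2 < dist (X₂ N ω) v} from hω)]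
        exact hFle _
      · simp only [Set.indicator_of_notMem (show ω ∉ {ω | δ' / 2 < dist (X₂ N ω) v} from hω)]
        exact (hFnear _ hω).le
    rw [integral_indicator_const _ (hA₂ N), smul_eq_mul, mul_comm] at h1
    simpa [measureReal_def] using h1
  -- the comparison sequence
  have hD := hF F hFlip hFbd
  have hP₂ : Tendsto (fun N => (P₂ N {ω | δ' / 2 < dist (X₂ N ω) v}).toReal) atTop (𝓝 0) := by
    have := h₂ (δ' / 2) (by positivity)
    rw [← ENNReal.toReal_zero]
    exact (ENNReal.tendsto_toReal_iff (fun N => measure_ne_top _ _) ENNReal.zero_ne_top).2 this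
  have hbound : ∀ N, (P₁ N {ω | δ < dist (X₁ N ω) v}).toReal ≤
      2 / δ' * ((∫ ω, F (X₁ N ω) ∂P₁ N) - ∫ ω, F (X₂ N ω) ∂P₂ N) +
        (P₂ N {ω | δ' / 2 < dist (X₂ N ω) v}).toReal := by
    intro N
    have h1 := hlow N
    have h2 := hup N
    have hδ2 : 0 < δ' / 2 := by positivity
    have key : δ' / 2 * (P₁ N {ω | δ < dist (X₁ N ω) v}).toReal ≤
        ((∫ ω, F (X₁ N ω) ∂P₁ N) - ∫ ω, F (X₂ N ω) ∂P₂ N) +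
          δ' / 2 * (P₂ N {ω | δ' / 2 < dist (X₂ N ω) v}).toReal := by linarith
    have h2δ : (2 / δ') * (δ' / 2) = 1 := by field_simp
    calc (P₁ N {ω | δ < dist (X₁ N ω) v}).toReal
        = (2 / δ') * (δ' / 2 * (P₁ N {ω | δ < dist (X₁ N ω) v}).toReal) := by
          rw [← mul_assoc, h2δ, one_mul]
      _ ≤ (2 / δ') * (((∫ ω, F (X₁ N ω) ∂P₁ N) - ∫ ω, F (X₂ N ω) ∂P₂ N) +
          δ' / 2 * (P₂ N {ω | δ' / 2 < dist (X₂ N ω) v}).toReal) :=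
          mul_le_mul_of_nonneg_left key (by positivity)
      _ = _ := by rw [mul_add, ← mul_assoc (2 / δ') (δ' / 2), h2δ, one_mul]
  have hlim : Tendsto (fun N => 2 / δ' * ((∫ ω, F (X₁ N ω) ∂P₁ N) - ∫ ω, F (X₂ N ω) ∂P₂ N) +
      (P₂ N {ω | δ' / 2 < dist (X₂ N ω) v}).toReal) atTop (𝓝 0) := by
    have := (hD.const_mul (2 / δ')).add hP₂
    simpa using this
  have hreal : Tendsto (fun N => (P₁ N {ω | δ < dist (X₁ N ω) v}).toReal) atTop (𝓝 0) :=
    squeeze_zero (fun N => ENNReal.toReal_nonneg) hbound hlim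
  exact (ENNReal.tendsto_toReal_iff (fun N => measure_ne_top _ _) ENNReal.zero_ne_top).1
    (by simpa using hreal)

end Summit.AtomisticToContinuum.HydrodynamicLimit.Theorems
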